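import Mathlib.NumberTheory.LegendreSymbol.QuadraticChar.Basic
import Mathlib.LinearAlgebra.Matrix.GeneralLinearGroup.Defs
import Mathlib.LinearAlgebra.Matrix.Notation
import Mathlib.LinearAlgebra.Matrix.Trace
import HarnessLib

/-!
# The auxiliary prime of ROAD A′ (Ihara-free L-TWIST), I: bad elements live in one Borel — PROVED

Cell `pub/bsd-wall`, seat `bsd-wall-manin-p1` (prover, explicit-unit on AKR crux #7
stmt-BirchSwinnertonDyer-20709 `ManinFrameResidueProperR`, line `tame_twist`; serves equally the sibling line
`route-BirchSwinnertonDyer-EdixhovenFibreFiveSeven`, cruxes TDS57 22227 / KP57 23810 / CORNER 23883 / LOW 23884).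
THEOREMS ONLY (no definition, no named fact, no `sorry`); route-free. BSD is not proved by this file.

ROAD A′ (MEMO-LTWIST-manin-p1-g6 §3; seats edix-p2/p3 g3, `LTwistTransfer*`): the transfer cycle gives L-TWIST at an
auxiliary prime `q ∤ 2pN` WITHOUT the three-copy Ihara lemma, provided `q* = (−1)^{(q−1)/2} q` is a non-square
mod `p`, `q ≢ 1 (mod p)` and `a_q ≢ ±(q+1) (mod p)`. By Chebotarev (sibling file `…AuxPrime.lean`) such a `q` is a
Frobenius whose class in `Gal(ℚ(E[p], i)/ℚ)` has: sign-twisted determinant a non-square, determinant `≠ 1`, trace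
`≠ ±(1 + det)`. This file and its sequel `…AuxPrimeGroup.lean` prove the finite group theory guaranteeing such a class (this file:
§§1–4, the Borel confinement of the "bad" elements; the sequel: regimes, absorption and the theorem), in the form

**Theorem** (`exists_nonsquare_det_trace_ne`). Let `p ≥ 5`, `Γ` a group, `ρ : Γ →* M₂(𝔽_p)` multiplicative
(a representation, written as matrices in a fixed frame), `s : Γ →* 𝔽_pˣ` with values `±1`, `c ∈ Γ` with
`ρ(c) = diag(1, −1)` and `s(c) = −1` (complex conjugation in the frame of its eigenvectors; `χ₋₄(c) = −1`),
such that (i) no line of `𝔽_p²` is stable under all `ρ(γ)`; (ii) `det ∘ ρ` is onto `𝔽_pˣ`; (iii) some `γ₀` has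
`s(γ₀)·det ρ(γ₀)` a non-square. Then some `γ` has `s(γ)·det ρ(γ)` a non-square, `det ρ(γ) ≠ 1` and
`tr ρ(γ) ≠ ±(1 + det ρ(γ))`.

Proof (Dickson-free and character-free; `ω(γ) := χ(s(γ) det ρ(γ))`, `χ` the quadratic character): if every `γ`
with `ω(γ) = −1`, `det ≠ 1` had `tr = ±(1 + det)`, then for `ω(γ) = −1`, `det ∉ {±1}`, applying this to `γ` and
`γc` gives `a + d = ±(1+u)`, `a − d = ±(1−u)`, whence `ad = u = det` and `bc = 0`: `ρ(γ)` is triangular in the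
`c`-frame, with `a ≠ d`, `a + d ≠ 0` (§3). A strictly upper `x` and a strictly lower `y` of this kind cannot
coexist: `yxy⁻¹` and `y⁻¹xy` are again of this kind, hence triangular, and the two vanishing entries force
`(a−d)(a′+d′) = 0` (§4). So all such elements are upper (say) triangular; the set is large enough — either
`(ω, det)` is jointly onto `{±1} × 𝔽_pˣ` (then `p ≡ 3 (mod 4)`, `p ≥ 7`) or `−1` is a square and `ω = χ ∘ det`
(§5) — to drag all of `Γ` into the Borel (§6), contradicting (i) (§7).

Axioms: `propext`, `Classical.choice`, `Quot.sound`.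

References: [DarmonDiamondTaylor1995] Lemma 4.12, §4.5 (the auxiliary primes of level raising, context only);
[Serre1972] §2 (subgroups of `GL₂(𝔽_p)`, context only — not used).
-/

set_option autoImplicit false
-- the Theorems directory repeats the summit name (sibling precedent `SignedBaseChangeAssembly.lean`)
set_option linter.dupNamespace false

namespace Summit.BirchSwinnertonDyer.BirchSwinnertonDyer.Theorems.AuxPrime

variable {p : ℕ} [Fact p.Prime] {Γ : Type*} [Group Γ]

/-! ### §1 Matrix bookkeeping for a multiplicative `ρ : Γ →* M₂(𝔽_p)` -/

/-- Entries of a product of `2 × 2` matrices. [folklore] -/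
theorem mul_apply_two {R : Type*} [CommRing R] (X Y : Matrix (Fin 2) (Fin 2) R) (i j : Fin 2) :
    (X * Y) i j = X i 0 * Y 0 j + X i 1 * Y 1 j := by
  rw [Matrix.mul_apply, Fin.sum_univ_two]

/-- `ρ(γ) ρ(γ⁻¹) = 1`. [folklore] -/
theorem map_mul_map_inv (ρ : Γ →* Matrix (Fin 2) (Fin 2) (ZMod p)) (γ : Γ) : ρ γ * ρ γ⁻¹ = 1 := by
  rw [← map_mul, mul_inv_cancel, map_one]

/-- `ρ(γ⁻¹) ρ(γ) = 1`. [folklore] -/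
theorem map_inv_mul_map (ρ : Γ →* Matrix (Fin 2) (Fin 2) (ZMod p)) (γ : Γ) : ρ γ⁻¹ * ρ γ = 1 := by
  rw [← map_mul, inv_mul_cancel, map_one]

/-- `det ρ(γ) · det ρ(γ⁻¹) = 1`. [folklore] -/
theorem det_mul_det_inv (ρ : Γ →* Matrix (Fin 2) (Fin 2) (ZMod p)) (γ : Γ) :
    (ρ γ).det * (ρ γ⁻¹).det = 1 := by
  rw [← Matrix.det_mul, map_mul_map_inv, Matrix.det_one]

/-- `det ρ(γ) ≠ 0`. [folklore] -/
theorem det_ne_zero (ρ : Γ →* Matrix (Fin 2) (Fin 2) (ZMod p)) (γ : Γ) : (ρ γ).det ≠ 0 := by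
  intro h
  have h1 := det_mul_det_inv ρ γ
  rw [h, zero_mul] at h1
  exact zero_ne_one h1

/-- `det ρ(y x y⁻¹) = det ρ(x)`. [folklore] -/
theorem det_conj (ρ : Γ →* Matrix (Fin 2) (Fin 2) (ZMod p)) (x y : Γ) :
    (ρ (y * x * y⁻¹)).det = (ρ x).det := by
  rw [map_mul, map_mul, Matrix.det_mul, Matrix.det_mul, mul_comm (ρ y).det, mul_assoc,
    det_mul_det_inv, mul_one]

/-- `det ρ(y⁻¹ x y) = det ρ(x)`. [folklore] -/
theorem det_conj' (ρ : Γ →* Matrix (Fin 2) (Fin 2) (ZMod p)) (x y : Γ) :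
    (ρ (y⁻¹ * x * y)).det = (ρ x).det := by
  have h := det_conj ρ x y⁻¹
  rwa [inv_inv] at h

/-- A character `ω : Γ → ℤˣ` is constant on conjugacy classes: `ω(y x y⁻¹) = ω(x)`. [folklore] -/
theorem units_conj (ω : Γ →* ℤˣ) (x y : Γ) : ω (y * x * y⁻¹) = ω x := by
  rw [map_mul, map_mul, map_inv, mul_inv_cancel_comm]

/-- `ω(y⁻¹ x y) = ω(x)`. [folklore] -/
theorem units_conj' (ω : Γ →* ℤˣ) (x y : Γ) : ω (y⁻¹ * x * y) = ω x := by
  have h := units_conj ω x y⁻¹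
  rwa [inv_inv] at h

/-- The upper Borel is closed under `ρ`-products: `ρ(x)₁₀ = ρ(y)₁₀ = 0 ⟹ ρ(xy)₁₀ = 0`. [folklore] -/
theorem upper_mul (ρ : Γ →* Matrix (Fin 2) (Fin 2) (ZMod p)) {x y : Γ} (hx : ρ x 1 0 = 0)
    (hy : ρ y 1 0 = 0) : ρ (x * y) 1 0 = 0 := by
  rw [map_mul, mul_apply_two, hx, hy, zero_mul, mul_zero, add_zero]

/-- The upper Borel is closed under `ρ`-inverses. [folklore] -/
theorem upper_inv (ρ : Γ →* Matrix (Fin 2) (Fin 2) (ZMod p)) {x : Γ} (hx : ρ x 1 0 = 0) :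
    ρ x⁻¹ 1 0 = 0 := by
  have h1 := congrFun (congrFun (map_mul_map_inv ρ x) 1) 0
  rw [mul_apply_two, hx, zero_mul, zero_add, Matrix.one_apply_ne (show (1 : Fin 2) ≠ 0 by decide)] at h1
  have hd : ρ x 1 1 ≠ 0 := by
    intro h0
    apply det_ne_zero ρ x
    rw [Matrix.det_fin_two, hx, h0]
    ring
  exact (mul_eq_zero.mp h1).resolve_left hd

/-- The lower Borel is closed under `ρ`-products. [folklore] -/
theorem lower_mul (ρ : Γ →* Matrix (Fin 2) (Fin 2) (ZMod p)) {x y : Γ} (hx : ρ x 0 1 = 0)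
    (hy : ρ y 0 1 = 0) : ρ (x * y) 0 1 = 0 := by
  rw [map_mul, mul_apply_two, hx, hy, zero_mul, mul_zero, add_zero]

/-- The lower Borel is closed under `ρ`-inverses. [folklore] -/
theorem lower_inv (ρ : Γ →* Matrix (Fin 2) (Fin 2) (ZMod p)) {x : Γ} (hx : ρ x 0 1 = 0) :
    ρ x⁻¹ 0 1 = 0 := by
  have h1 := congrFun (congrFun (map_mul_map_inv ρ x) 0) 1
  rw [mul_apply_two, hx, zero_mul, add_zero, Matrix.one_apply_ne (show (0 : Fin 2) ≠ 1 by decide)] at h1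
  have hd : ρ x 0 0 ≠ 0 := by
    intro h0
    apply det_ne_zero ρ x
    rw [Matrix.det_fin_two, hx, h0]
    ring
  exact (mul_eq_zero.mp h1).resolve_left hd

/-! ### §2 Arithmetic of `𝔽_p`, `p ≥ 5` -/

/-- `2 ≠ ±1` in `𝔽_p` for `p ≥ 5`. [folklore] -/
theorem two_ne_one_and_neg_one (hp5 : 5 ≤ p) : (2 : ZMod p) ≠ 1 ∧ (2 : ZMod p) ≠ -1 := by
  constructor
  · intro h
    have h' : ((1 : ℕ) : ZMod p) = 0 := by
      rw [Nat.cast_one]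
      linear_combination h
    rw [ZMod.natCast_eq_zero_iff] at h'
    have := Nat.le_of_dvd (by norm_num) h'
    omega
  · intro h
    have h' : ((3 : ℕ) : ZMod p) = 0 := by
      rw [Nat.cast_ofNat]
      linear_combination h
    rw [ZMod.natCast_eq_zero_iff] at h'
    have := Nat.le_of_dvd (by norm_num) h'
    omega

/-- If `−1` is not a square in `𝔽_p` and `p ≥ 5` then `p ≥ 7` (`p ≡ 3 (mod 4)`). [folklore] -/
theorem seven_le_of_not_isSquare_neg_one (hp5 : 5 ≤ p) (h : ¬ IsSquare (-1 : ZMod p)) : 7 ≤ p := by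
  rw [FiniteField.isSquare_neg_one_iff, ZMod.card, not_not] at h
  omega

/-- In `𝔽_p` with `p ≥ 7`, given `w`, some `v ≠ 0` has `2v ≠ ±1` and `2vw ≠ ±1` (five excluded values).
[folklore] -/
theorem exists_avoid (hp7 : 7 ≤ p) (w : ZMod p) :
    ∃ v : ZMod p, v ≠ 0 ∧ 2 * v ≠ 1 ∧ 2 * v ≠ -1 ∧ 2 * v * w ≠ 1 ∧ 2 * v * w ≠ -1 := by
  classical
  set bad : Finset (ZMod p) :=
    {0, (2 : ZMod p)⁻¹, -(2 : ZMod p)⁻¹, (2 * w)⁻¹, -(2 * w)⁻¹} with hbad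
  have hlt : bad.card < (Finset.univ : Finset (ZMod p)).card := by
    rw [Finset.card_univ, ZMod.card]
    exact lt_of_le_of_lt Finset.card_le_five (by omega)
  obtain ⟨v, -, hv⟩ := Finset.exists_mem_notMem_of_card_lt_card hlt
  simp only [hbad, Finset.mem_insert, Finset.mem_singleton, not_or] at hv
  obtain ⟨hv0, hv1, hv2, hv3, hv4⟩ := hv
  refine ⟨v, hv0, fun h ↦ hv1 ?_, fun h ↦ hv2 ?_, fun h ↦ hv3 ?_, fun h ↦ hv4 ?_⟩
  · exact eq_inv_of_mul_eq_one_right h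
  · have h' : (2 : ZMod p) * (-v) = 1 := by rw [mul_neg, h, neg_neg]
    have := eq_inv_of_mul_eq_one_right h'
    rw [← this, neg_neg]
  · have h' : (2 * w) * v = 1 := by rw [mul_right_comm]; exact h
    exact eq_inv_of_mul_eq_one_right h'
  · have h' : (2 * w) * (-v) = 1 := by rw [mul_neg, mul_right_comm, h, neg_neg]
    have := eq_inv_of_mul_eq_one_right h'
    rw [← this, neg_neg]

/-! ### §3 Bad elements off `det = ±1` are triangular in the frame of complex conjugation -/

/-- **Triangularity.** With `ρ(c) = diag(1, −1)`, `ω(c) = 1` and the standing "badness" hypothesis `hB`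
(every `γ` with `ω(γ) = −1`, `det ρ(γ) ≠ 1` has `tr ρ(γ) = ±(1 + det ρ(γ))`): every `γ` with `ω(γ) = −1` and
`det ρ(γ) ∉ {1, −1}` has `ρ(γ)₀₁ ρ(γ)₁₀ = 0`, `ρ(γ)₀₀ ≠ ρ(γ)₁₁`, `ρ(γ)₀₀ + ρ(γ)₁₁ ≠ 0` (apply `hB` to `γ` and
to `γc`: `a + d = ±(1+u)`, `a − d = ±(1−u)`, so `4ad = 4u`). [folklore] -/
theorem triangular_of_bad (hp5 : 5 ≤ p) (ρ : Γ →* Matrix (Fin 2) (Fin 2) (ZMod p)) (ω : Γ →* ℤˣ)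
    {c : Γ} (hc : ρ c = !![1, 0; 0, -1]) (hωc : ω c = 1)
    (hB : ∀ γ, ω γ = -1 → (ρ γ).det ≠ 1 →
      (ρ γ).trace = 1 + (ρ γ).det ∨ (ρ γ).trace = -(1 + (ρ γ).det))
    {γ : Γ} (hω : ω γ = -1) (h1 : (ρ γ).det ≠ 1) (h1' : (ρ γ).det ≠ -1) :
    ρ γ 0 1 * ρ γ 1 0 = 0 ∧ ρ γ 0 0 ≠ ρ γ 1 1 ∧ ρ γ 0 0 + ρ γ 1 1 ≠ 0 := by
  have hC00 : ρ c 0 0 = 1 := by rw [hc]; simp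
  have hC01 : ρ c 0 1 = 0 := by rw [hc]; simp
  have hC10 : ρ c 1 0 = 0 := by rw [hc]; simp
  have hC11 : ρ c 1 1 = -1 := by rw [hc]; simp
  have hdetc : (ρ c).det = -1 := by rw [Matrix.det_fin_two, hC00, hC01, hC10, hC11]; ring
  have htr := hB γ hω h1
  have hγc : ω (γ * c) = -1 := by rw [map_mul, hωc, mul_one, hω]
  have hdet' : (ρ (γ * c)).det = -(ρ γ).det := by
    rw [map_mul, Matrix.det_mul, hdetc, mul_neg, mul_one]
  have h1c : (ρ (γ * c)).det ≠ 1 := by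
    rw [hdet']
    intro h
    exact h1' (by rw [← h, neg_neg])
  have htrc := hB (γ * c) hγc h1c
  have htrc' : (ρ (γ * c)).trace = ρ γ 0 0 - ρ γ 1 1 := by
    rw [map_mul, Matrix.trace_fin_two, mul_apply_two, mul_apply_two, hC00, hC01, hC10, hC11]
    ring
  rw [htrc', hdet'] at htrc
  rw [Matrix.trace_fin_two] at htr
  have hdet : (ρ γ).det = ρ γ 0 0 * ρ γ 1 1 - ρ γ 0 1 * ρ γ 1 0 := Matrix.det_fin_two _
  set a := ρ γ 0 0
  set b := ρ γ 0 1
  set e := ρ γ 1 0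
  set d := ρ γ 1 1
  set u := (ρ γ).det
  have key : 4 * (a * d) = 4 * u := by
    rcases htr with h | h <;> rcases htrc with h' | h'
    · linear_combination (a + d + (1 + u)) * h - (a - d + (1 - u)) * h'
    · linear_combination (a + d + (1 + u)) * h - (a - d - (1 - u)) * h'
    · linear_combination (a + d - (1 + u)) * h - (a - d + (1 - u)) * h'
    · linear_combination (a + d - (1 + u)) * h - (a - d - (1 - u)) * h'
  have had : a * d = u := by
    have h4 : (4 : ZMod p) ≠ 0 := by
      intro h
      have h' : ((4 : ℕ) : ZMod p) = 0 := by rw [Nat.cast_ofNat]; exact h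
      rw [ZMod.natCast_eq_zero_iff] at h'
      have := Nat.le_of_dvd (by norm_num) h'
      omega
    have : (4 : ZMod p) * (a * d - u) = 0 := by linear_combination key
    rcases mul_eq_zero.mp this with h | h
    · exact absurd h h4
    · exact sub_eq_zero.mp h
  refine ⟨?_, ?_, ?_⟩
  · linear_combination had + hdet
  · intro hadeq
    rcases htrc with h' | h'
    · apply h1
      linear_combination h' - hadeq
    · apply h1
      linear_combination hadeq - h'
  · intro h0
    rcases htr with h | h
    · apply h1'
      linear_combination h0 - h
    · apply h1'
      linear_combination -(h0 - h)

/-! ### §4 A strictly upper and a strictly lower bad element cannot coexist -/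

/-- **No mixed pair.** Under the hypotheses of `triangular_of_bad`, there are no `x, y` with `ω = −1`,
`det ∉ {±1}`, `ρ(x)` strictly upper triangular and `ρ(y)` strictly lower triangular: `ρ(yxy⁻¹)` and
`ρ(y⁻¹xy)` would both be triangular with a non-zero upper-right entry, and the vanishing of their lower-left
entries gives `(x₀₀ − x₁₁)(y₀₀ + y₁₁) = 0`. [folklore] -/
theorem no_mixed_pair (hp5 : 5 ≤ p) (ρ : Γ →* Matrix (Fin 2) (Fin 2) (ZMod p)) (ω : Γ →* ℤˣ)
    {c : Γ} (hc : ρ c = !![1, 0; 0, -1]) (hωc : ω c = 1)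
    (hB : ∀ γ, ω γ = -1 → (ρ γ).det ≠ 1 →
      (ρ γ).trace = 1 + (ρ γ).det ∨ (ρ γ).trace = -(1 + (ρ γ).det))
    {x y : Γ} (hx : ω x = -1) (hx1 : (ρ x).det ≠ 1) (hx1' : (ρ x).det ≠ -1)
    (hy : ω y = -1) (hy1 : (ρ y).det ≠ 1) (hy1' : (ρ y).det ≠ -1)
    (hxu : ρ x 1 0 = 0) (hxb : ρ x 0 1 ≠ 0) (hyl : ρ y 0 1 = 0) (hye : ρ y 1 0 ≠ 0) : False := by
  have Tx := triangular_of_bad hp5 ρ ω hc hωc hB hx hx1 hx1'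
  have Ty := triangular_of_bad hp5 ρ ω hc hωc hB hy hy1 hy1'
  -- the conjugates `y x y⁻¹`, `y⁻¹ x y`
  have TP := triangular_of_bad hp5 ρ ω hc hωc hB (γ := y * x * y⁻¹)
    (by rw [units_conj, hx]) (by rw [det_conj]; exact hx1) (by rw [det_conj]; exact hx1')
  have TQ := triangular_of_bad hp5 ρ ω hc hωc hB (γ := y⁻¹ * x * y)
    (by rw [units_conj', hx]) (by rw [det_conj']; exact hx1) (by rw [det_conj']; exact hx1')
  set X := ρ x with hX
  set Y := ρ y with hY
  set Y' := ρ y⁻¹ with hY'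
  have hYY' : Y * Y' = 1 := map_mul_map_inv ρ y
  -- entries of `Y Y' = 1`
  have hY00 : Y 0 0 ≠ 0 := by
    intro h0
    apply det_ne_zero ρ y
    rw [← hY, Matrix.det_fin_two, hyl, h0]
    ring
  have e01 : Y' 0 1 = 0 := by
    have h := congrFun (congrFun hYY' 0) 1
    rw [mul_apply_two, hyl, zero_mul, add_zero, Matrix.one_apply_ne (show (0 : Fin 2) ≠ 1 by decide)] at h
    exact (mul_eq_zero.mp h).resolve_left hY00
  have e00 : Y 0 0 * Y' 0 0 = 1 := by
    have h := congrFun (congrFun hYY' 0) 0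
    rwa [mul_apply_two, hyl, zero_mul, add_zero, Matrix.one_apply_eq] at h
  have e11 : Y 1 1 * Y' 1 1 = 1 := by
    have h := congrFun (congrFun hYY' 1) 1
    rwa [mul_apply_two, e01, mul_zero, zero_add, Matrix.one_apply_eq] at h
  have e10 : Y 1 0 * Y' 0 0 + Y 1 1 * Y' 1 0 = 0 := by
    have h := congrFun (congrFun hYY' 1) 0
    rwa [mul_apply_two, Matrix.one_apply_ne (show (1 : Fin 2) ≠ 0 by decide)] at h
  have hY'11 : Y' 1 1 ≠ 0 := fun h0 ↦ by
    rw [h0, mul_zero] at e11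
    exact zero_ne_one e11
  have hY'00 : Y' 0 0 ≠ 0 := fun h0 ↦ by
    rw [h0, mul_zero] at e00
    exact zero_ne_one e00
  have hY11 : Y 1 1 ≠ 0 := fun h0 ↦ by
    rw [h0, zero_mul] at e11
    exact zero_ne_one e11
  -- `P = Y X Y'`
  have hP : ρ (y * x * y⁻¹) = Y * X * Y' := by rw [map_mul, map_mul]
  have hP01 : ρ (y * x * y⁻¹) 0 1 = Y 0 0 * X 0 1 * Y' 1 1 := by
    rw [hP, mul_apply_two, mul_apply_two, mul_apply_two, hyl, hxu, e01]
    ring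
  have hP10 : ρ (y * x * y⁻¹) 1 0 =
      Y 1 0 * X 0 0 * Y' 0 0 + Y 1 0 * X 0 1 * Y' 1 0 + Y 1 1 * X 1 1 * Y' 1 0 := by
    rw [hP, mul_apply_two, mul_apply_two, mul_apply_two, hxu]
    ring
  have hP01' : ρ (y * x * y⁻¹) 0 1 ≠ 0 := by
    rw [hP01]
    exact mul_ne_zero (mul_ne_zero hY00 hxb) hY'11
  have hP10' : Y 1 0 * X 0 0 * Y' 0 0 + Y 1 0 * X 0 1 * Y' 1 0 + Y 1 1 * X 1 1 * Y' 1 0 = 0 := by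
    rw [← hP10]
    exact (mul_eq_zero.mp TP.1).resolve_left hP01'
  -- `Q = Y' X Y`
  have hQ : ρ (y⁻¹ * x * y) = Y' * X * Y := by rw [map_mul, map_mul]
  have hQ01 : ρ (y⁻¹ * x * y) 0 1 = Y' 0 0 * X 0 1 * Y 1 1 := by
    rw [hQ, mul_apply_two, mul_apply_two, mul_apply_two, hyl, hxu, e01]
    ring
  have hQ10 : ρ (y⁻¹ * x * y) 1 0 =
      Y' 1 0 * X 0 0 * Y 0 0 + Y' 1 0 * X 0 1 * Y 1 0 + Y' 1 1 * X 1 1 * Y 1 0 := by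
    rw [hQ, mul_apply_two, mul_apply_two, mul_apply_two, hxu]
    ring
  have hQ01' : ρ (y⁻¹ * x * y) 0 1 ≠ 0 := by
    rw [hQ01]
    exact mul_ne_zero (mul_ne_zero hY'00 hxb) hY11
  have hQ10' : Y' 1 0 * X 0 0 * Y 0 0 + Y' 1 0 * X 0 1 * Y 1 0 + Y' 1 1 * X 1 1 * Y 1 0 = 0 := by
    rw [← hQ10]
    exact (mul_eq_zero.mp TQ.1).resolve_left hQ01'
  -- elimination of `Y'`
  have E1 : Y 1 0 * (X 0 0 * Y 1 1 - X 0 1 * Y 1 0 - X 1 1 * Y 1 1) = 0 := by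
    linear_combination (Y 0 0 * Y 1 1) * hP10' - (Y 1 0 * X 0 0 * Y 1 1) * e00
      - (Y 1 0 * X 0 1 + Y 1 1 * X 1 1) * Y 0 0 * e10
      + (Y 1 0 * X 0 1 + Y 1 1 * X 1 1) * Y 1 0 * e00
  have E2 : Y 1 0 * (-(X 0 0 * Y 0 0) - X 0 1 * Y 1 0 + X 1 1 * Y 0 0) = 0 := by
    linear_combination (Y 0 0 * Y 1 1) * hQ10' - (X 0 0 * Y 0 0 + X 0 1 * Y 1 0) * Y 0 0 * e10
      + (X 0 0 * Y 0 0 + X 0 1 * Y 1 0) * Y 1 0 * e00 - X 1 1 * Y 1 0 * Y 0 0 * e11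
  have F1 : X 0 0 * Y 1 1 - X 0 1 * Y 1 0 - X 1 1 * Y 1 1 = 0 :=
    (mul_eq_zero.mp E1).resolve_left hye
  have F2 : -(X 0 0 * Y 0 0) - X 0 1 * Y 1 0 + X 1 1 * Y 0 0 = 0 :=
    (mul_eq_zero.mp E2).resolve_left hye
  have F : (X 0 0 - X 1 1) * (Y 0 0 + Y 1 1) = 0 := by linear_combination F1 - F2
  rcases mul_eq_zero.mp F with h | h
  · exact Tx.2.1 (sub_eq_zero.mp h)
  · exact Ty.2.2 h

/-- **All bad elements off `det = ±1` lie in ONE Borel**: either all are upper triangular or all are lower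
triangular (from `triangular_of_bad` and `no_mixed_pair`). [folklore] -/
theorem upper_or_lower (hp5 : 5 ≤ p) (ρ : Γ →* Matrix (Fin 2) (Fin 2) (ZMod p)) (ω : Γ →* ℤˣ)
    {c : Γ} (hc : ρ c = !![1, 0; 0, -1]) (hωc : ω c = 1)
    (hB : ∀ γ, ω γ = -1 → (ρ γ).det ≠ 1 →
      (ρ γ).trace = 1 + (ρ γ).det ∨ (ρ γ).trace = -(1 + (ρ γ).det)) :
    (∀ γ, ω γ = -1 → (ρ γ).det ≠ 1 → (ρ γ).det ≠ -1 → ρ γ 1 0 = 0) ∨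
    (∀ γ, ω γ = -1 → (ρ γ).det ≠ 1 → (ρ γ).det ≠ -1 → ρ γ 0 1 = 0) := by
  by_contra h
  push Not at h
  obtain ⟨⟨y, hy, hy1, hy1', hye⟩, ⟨x, hx, hx1, hx1', hxb⟩⟩ := h
  have Tx := triangular_of_bad hp5 ρ ω hc hωc hB hx hx1 hx1'
  have Ty := triangular_of_bad hp5 ρ ω hc hωc hB hy hy1 hy1'
  have hxu : ρ x 1 0 = 0 := (mul_eq_zero.mp Tx.1).resolve_left hxb
  have hyl : ρ y 0 1 = 0 := (mul_eq_zero.mp Ty.1).resolve_right hye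
  exact no_mixed_pair hp5 ρ ω hc hωc hB hx hx1 hx1' hy hy1 hy1' hxu hxb hyl hye

end Summit.BirchSwinnertonDyer.BirchSwinnertonDyer.Theorems.AuxPrime
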